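import Literature.NumberTheory.Automorphic.AsaiAtOneOfHolomorphy
import Literature.NumberTheory.Automorphic.AutomorphicRepsGLSatakeFlathProofs
import Mathlib.Analysis.SpecialFunctions.Pow.Asymptotics
import Mathlib.Analysis.SpecialFunctions.Pow.Deriv
import Mathlib.Analysis.Calculus.Deriv.Polynomial
import Mathlib.Analysis.Complex.RemovableSingularity
import HarnessLib

/-!
# Mok's Asai-pole dichotomy in continuation form, reduced to holomorphy: the glue of the
# printed proof (Grbac–Shahidi 2015, end of the proof of Thm. 4.3) on `{1/2 < Re s}`

Topic `NumberTheory/Automorphic`; namespace `Literature.NumberTheory.Automorphic`. Proof file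
(theorems only: no definition, no named fact, no instance), sibling of `AsaiSignCont` (the named
fact `Mok2014_partialAsaiL_continuation_pole_dichotomy`) and of `AsaiAtOneOfHolomorphy` (the same
glue at `s = 1` only, for the `s = 1` fact `GrbacShahidi2015_partialAsaiL_at_one`).

## What is proved

The printed proof of the dichotomy (Mok, §2.5, paragraph before Thm. 2.5.4; in full Grbac–Shahidi
2015, Thm. 4.3 (2), proof pp. 204–206) has three inputs:

* (H) **holomorphy** — Grbac–Shahidi, Thm. 4.3 (2)(a), holomorphy part: for a Galois self-dual
  cuspidal `σ`, "`L(s, σ, r_A)` is entire, except for possible simple poles at `s = 0` and `s = 1`"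
  (Langlands–Shahidi method on `U(n, n)`: Thm. 2.1, Thm. 4.1 — the latter through Mok's endoscopic
  classification for `0 < Re s < 1/2` —, and the functional equation); for the PARTIAL function of a
  datum `(S, A)` (finitely many reciprocal local factors, entire) and the half-plane of the fact:
  `(s - 1) L^S(s, Π, As^η)` extends holomorphically to `{1/2 < Re s}`, for both signs `η`;
* (RS) **Rankin–Selberg** — "The poles of the Rankin–Selberg `L`-function `L(s, σ × σ^θ)` are known
  from [Jacquet and Shalika 1981]. For `σ` Galois self-dual it has a simple pole at `s = 1`" (p. 206;
  Mok: "hence has a simple pole at `s = 1` by [JPSS]"): here for the raw partial product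
  `R(s) = L^{S_E}(s, A ⊗ A^c)` off the places of `E` above `S` — multipliable and holomorphic on
  `{1 < Re s}`, `(s - 1) R(s) → r ≠ 0` as `s → 1`, `Re s > 1` (the statements of the tree's
  `JacquetShalika1981_partialPairL_{multipliable,pole}_repData` for the pair `(Π, Π^c)`, kept as a
  hypothesis for want of the Galois-conjugate Borel–Jacquet datum `Π^c`, exactly as in
  `GrbacShahidi2015_partialAsaiL_at_one_of_holomorphy`);
* (G) **the glue**: the factorisation `(∗∗) L(s, σ × σ^θ) = L(s, σ, r_A) L(s, σ, r_A ⊗ δ_{E/F})`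
  (Goldberg; Mok §2.5; for Satake families `partialPairL_smul_eq_partialAsaiL_mul`) and the order
  count at `s = 1`: "both Asai `L`-functions … have at most a simple pole at `s = 1`. Hence, they are
  both nonzero at `s = 1`, and exactly one of them has a simple pole at `s = 1`" (p. 206).

This file PROVES (G) in the currency of the fact and thereby
`Mok2014_partialAsaiL_continuation_pole_dichotomy_of_holomorphy`: **(H) and (RS) imply the named
fact verbatim.** Beyond the order count of `AsaiAtOneOfHolomorphy` two things are needed here and
proved: the holomorphic member of the pair is continued to all of `{1/2 < Re s}` as
`dslope G 1 = G(s)/(s - 1)` (removable singularity at the simple zero `s = 1` of the continuation `G`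
of `(s - 1) L^S`); and the pole sign is INDEPENDENT OF THE ASAI DATUM (the fact quantifies
`∃ η, ∀ (S, A)`): two data `(S, A)`, `(S₀, A₀)` of `Π` are compared through `(S ∪ S₀, A)` and
`(S ∪ S₀, A₀)` — enlarging `S` multiplies `L^S` by finitely many unramified factors
`det(1 - As^η(t_v) q_v^{-s})`, entire in `s` and non-zero far to the right
(`partialAsaiL_eq_prod_mul_partialAsaiL`, `exists_forall_eval_asaiLocalPolynomial_ne_zero`), so a
holomorphic continuation for `S` yields one for `S ∪ S₀`, which a continued simple pole of the same
sign excludes (`continuation_pole_not_holomorphic`); and `A = A₀` above the complement of `S ∪ S₀` by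
the uniqueness of Satake parameters (`AutomorphicRepData.hasSatakeParamAt_unique_holds`, Flath).
Clause (i) of the fact (multipliability far to the right) is the proved
`CuspidalAutomorphicRepData.exists_multipliable_asaiEulerFactors`.  Conversely the fact gives back
(H) (`hol_half_plane_of_Mok2014_partialAsaiL_continuation_pole_dichotomy`), so that **granted (RS)
the named fact is equivalent to (H)**: what the tree lacks for Mok's dichotomy is exactly
Grbac–Shahidi's holomorphy theorem for the continued partial Asai `L`-functions of conjugate
self-dual cuspidal `Π` on `{1/2 < Re s}` (and the datum `Π^c` feeding the Jacquet–Shalika facts).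

What this does NOT give: the fact itself (neither (H) — Eisenstein series on quasi-split unitary
groups, their constant terms and poles — nor the datum `Π^c` for (RS) is in the tree).

## References

* C. P. Mok, *Endoscopic classification of representations of quasi-split unitary groups*,
  Mem. Amer. Math. Soc. 235 (2015), no. 1108, §2.5 (paragraph before Thm. 2.5.4) and Thm. 2.5.4 (a).
  [Mok2014]
* N. Grbac, F. Shahidi, *Endoscopic transfer for unitary groups and holomorphy of Asai
  `L`-functions*, Pacific J. Math. 276 (2015), 185–211: Thm. 4.3 (pp. 186, 204) and its proof,
  pp. 204–206 (`(∗∗)`, Remark 4.4). [GrbacShahidi2015]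
* J. Arthur, L. Clozel, *Simple algebras, base change, and the advanced theory of the trace formula*,
  Ann. of Math. Stud. 120 (1989), Ch. 3 §2, (2.3). [ArthurClozelAMS120]
* D. Flath, *Decomposition of representations into tensor products*, Corvallis 1979, Thm. 3.
  [FlathCorvallis1979]
-/

noncomputable section

open scoped Topology
open NumberField IsDedekindDomain Filter Polynomial

namespace Literature.NumberTheory.Automorphic

/-! ### The order count on the half-plane `{1/2 < Re s}` for an abstract pair `L₁ L₂ = R` -/

section Analysis

/-- `{1/2 < Re s}` is a neighbourhood of `1`. [folklore] -/
theorem half_lt_re_mem_nhds_one : {s : ℂ | 1 / 2 < s.re} ∈ 𝓝 (1 : ℂ) :=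
  (isOpen_lt continuous_const Complex.continuous_re).mem_nhds (by
    simp only [Set.mem_setOf_eq, Complex.one_re]
    norm_num)

/-- **The dichotomy for an abstract pair, on `{1/2 < Re s}`** (Grbac–Shahidi, end of the proof of
Thm. 4.3: "both Asai `L`-functions … have at most a simple pole at `s = 1`. Hence, they are both
nonzero at `s = 1`, and exactly one of them has a simple pole at `s = 1`").  Let `G₁`, `G₂` be
holomorphic on `{1/2 < Re s}` with `G_i = (s - 1) L_i` on `{σ < Re s}` (`σ ≥ 1`), let
`(s - 1) R(s) → r ≠ 0` as `s → 1`, `Re s > 1`, and `G₁ G₂ = (s - 1)² R` near `1` in `{1 < Re s}`.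
Then either `G₁(1) ≠ 0` (a continued simple pole of `L₁`) and `L₂` has a continuation `H` to
`{1/2 < Re s}` with `H(1) ≠ 0`, or the same with the indices exchanged.  The continuation is
`H = dslope G_i 1` (removable singularity at the simple zero of `G_i`), with `H(1) = G_i'(1) ≠ 0` by
the order count `G_j(1) G_i'(1) = r` (`apply_one_mul_deriv_one_eq_of_pole`).
[cite: GrbacShahidi2015, proof of Thm. 4.3, p. 206] -/
theorem dichotomy_of_continuations_half_plane {L₁ L₂ R G₁ G₂ : ℂ → ℂ} {σ : ℝ} {r : ℂ}
    (hσ : 1 ≤ σ) (hG₁ : DifferentiableOn ℂ G₁ {s : ℂ | 1 / 2 < s.re})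
    (hG₂ : DifferentiableOn ℂ G₂ {s : ℂ | 1 / 2 < s.re})
    (hGL₁ : ∀ s : ℂ, σ < s.re → G₁ s = (s - 1) * L₁ s)
    (hGL₂ : ∀ s : ℂ, σ < s.re → G₂ s = (s - 1) * L₂ s) (hr : r ≠ 0)
    (hR : Tendsto (fun s => (s - 1) * R s) (𝓝[{s : ℂ | 1 < s.re}] 1) (𝓝 r))
    (hfac : ∀ᶠ s in 𝓝[{s : ℂ | 1 < s.re}] (1 : ℂ), G₁ s * G₂ s = (s - 1) ^ 2 * R s) :
    (G₁ 1 ≠ 0 ∧ ∃ H : ℂ → ℂ, DifferentiableOn ℂ H {s : ℂ | 1 / 2 < s.re} ∧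
        (∀ s : ℂ, σ < s.re → H s = L₂ s) ∧ H 1 ≠ 0) ∨
      (G₂ 1 ≠ 0 ∧ ∃ H : ℂ → ℂ, DifferentiableOn ℂ H {s : ℂ | 1 / 2 < s.re} ∧
        (∀ s : ℂ, σ < s.re → H s = L₁ s) ∧ H 1 ≠ 0) := by
  have hG₁' : DifferentiableOn ℂ G₁ ({s : ℂ | 1 < s.re} ∪ Metric.ball (1 : ℂ) (1 / 2)) :=
    hG₁.mono one_lt_re_union_ball_one_half_subset
  have hG₂' : DifferentiableOn ℂ G₂ ({s : ℂ | 1 < s.re} ∪ Metric.ball (1 : ℂ) (1 / 2)) :=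
    hG₂.mono one_lt_re_union_ball_one_half_subset
  have h0 := apply_one_mul_apply_one_eq_zero_of_pole one_half_pos hG₁' hG₂' hR hfac
  rcases mul_eq_zero.mp h0 with h1 | h2
  · -- `G₁(1) = 0`: `L₁` is holomorphic at `1`, the pole is carried by `L₂`
    right
    have hfac' : ∀ᶠ s in 𝓝[{s : ℂ | 1 < s.re}] (1 : ℂ), G₂ s * G₁ s = (s - 1) ^ 2 * R s :=
      hfac.mono fun s hs => by rw [mul_comm, hs]
    have key := apply_one_mul_deriv_one_eq_of_pole one_half_pos hG₂' hG₁' hR hfac' h1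
    have hG₂1 : G₂ 1 ≠ 0 := fun h => hr (by rw [← key, h, zero_mul])
    have hd : deriv G₁ 1 ≠ 0 := fun h => hr (by rw [← key, h, mul_zero])
    exact ⟨hG₂1, dslope G₁ 1, (Complex.differentiableOn_dslope half_lt_re_mem_nhds_one).mpr hG₁,
      fun s hs => dslope_one_eq_of_eq_sub_one_mul hσ h1 hGL₁ hs, by rwa [dslope_same]⟩
  · -- `G₂(1) = 0`: symmetric
    left
    have key := apply_one_mul_deriv_one_eq_of_pole one_half_pos hG₁' hG₂' hR hfac h2
    have hG₁1 : G₁ 1 ≠ 0 := fun h => hr (by rw [← key, h, zero_mul])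
    have hd : deriv G₂ 1 ≠ 0 := fun h => hr (by rw [← key, h, mul_zero])
    exact ⟨hG₁1, dslope G₂ 1, (Complex.differentiableOn_dslope half_lt_re_mem_nhds_one).mpr hG₂,
      fun s hs => dslope_one_eq_of_eq_sub_one_mul hσ h2 hGL₂ hs, by rwa [dslope_same]⟩

end Analysis

/-! ### Unramified Asai factors: dependence on the family, non-vanishing far to the right,
holomorphy, and splitting off finitely many of them -/

section Local

variable {F E : Type} [Field F] [Field E] [Algebra F E]

/-- The local Asai polynomial at `w` depends on the Satake family only through its values at `w`
and `c • w`. [folklore] -/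
theorem asaiLocalPolynomial_congr {c : E ≃ₐ[F] E} {A A' : SatakeFamily E} (η : ℤˣ)
    {w : HeightOneSpectrum (𝓞 E)} (hw : A w = A' w) (hcw : A (c • w) = A' (c • w)) :
    asaiLocalPolynomial c A η w = asaiLocalPolynomial c A' η w := by
  by_cases h : c • w = w
  · rw [asaiLocalPolynomial_of_smul_eq A η h, asaiLocalPolynomial_of_smul_eq A' η h, hw]
  · rw [asaiLocalPolynomial_of_smul_ne A η h, asaiLocalPolynomial_of_smul_ne A' η h, hw, hcw]

/-- **The unramified Asai factor at a fixed place does not vanish for `Re s` large**: with `M ≥ 1`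
bounding the Satake parameters at `w` and `c • w`, `det(1 - As^η(t_v) q^{-s})` is a product of
numbers `1 - ζ` with `‖ζ‖ ≤ M² q^{-Re s} < 1` as soon as `q^{-Re s} < M⁻²`
(`eval_asaiLocalPolynomial_ne_zero_of_norm_le`; `q^{-r} → 0`). [folklore] -/
theorem exists_forall_eval_asaiLocalPolynomial_ne_zero (c : E ≃ₐ[F] E) (A : SatakeFamily E)
    (w : HeightOneSpectrum (𝓞 E)) {q : ℕ} (hq : 1 < q) :
    ∃ σ : ℝ, ∀ (η : ℤˣ) (s : ℂ), σ < s.re →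
      (asaiLocalPolynomial c A η w).eval ((q : ℂ) ^ (-s)) ≠ 0 := by
  -- a common bound `M ≥ 1` for the Satake parameters at `w` and `c • w`
  set M : ℝ := 1 + ((A w).map (‖·‖)).sum + ((A (c • w)).map (‖·‖)).sum with hM
  have hs₁ : 0 ≤ ((A w).map (‖·‖)).sum :=
    Multiset.sum_nonneg fun x hx => by
      obtain ⟨a, -, rfl⟩ := Multiset.mem_map.mp hx
      exact norm_nonneg a
  have hs₂ : 0 ≤ ((A (c • w)).map (‖·‖)).sum :=
    Multiset.sum_nonneg fun x hx => by
      obtain ⟨a, -, rfl⟩ := Multiset.mem_map.mp hx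
      exact norm_nonneg a
  have hM1 : 1 ≤ M := by rw [hM]; linarith
  have hwM : ∀ a ∈ A w, ‖a‖ ≤ M := fun a ha => by
    have h : ‖a‖ ≤ ((A w).map (‖·‖)).sum :=
      Multiset.single_le_sum (fun x hx => by
        obtain ⟨b, -, rfl⟩ := Multiset.mem_map.mp hx
        exact norm_nonneg b) _ (Multiset.mem_map_of_mem _ ha)
    rw [hM]; linarith
  have hcwM : ∀ a ∈ A (c • w), ‖a‖ ≤ M := fun a ha => by
    have h : ‖a‖ ≤ ((A (c • w)).map (‖·‖)).sum :=
      Multiset.single_le_sum (fun x hx => by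
        obtain ⟨b, -, rfl⟩ := Multiset.mem_map.mp hx
        exact norm_nonneg b) _ (Multiset.mem_map_of_mem _ ha)
    rw [hM]; linarith
  -- `q^{r} → 0` as `r → -∞`
  have hq' : (1 : ℝ) < q := by exact_mod_cast hq
  have hM2 : 0 < M ^ 2 := by positivity
  have hev : ∀ᶠ r : ℝ in atBot, (q : ℝ) ^ r < (M ^ 2)⁻¹ :=
    (tendsto_rpow_atBot_of_base_gt_one (q : ℝ) hq').eventually (gt_mem_nhds (inv_pos.mpr hM2))
  obtain ⟨r₀, hr₀⟩ := Filter.eventually_atBot.mp hev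
  refine ⟨max 0 (-r₀), fun η s hs => ?_⟩
  have hs0 : 0 ≤ s.re := (le_max_left _ _).trans hs.le
  have hsr : -s.re ≤ r₀ := by
    have h := (le_max_right 0 (-r₀)).trans hs.le
    linarith
  have hq0 : 0 < q := zero_lt_one.trans hq
  have hx : ‖(q : ℂ) ^ (-s)‖ = (q : ℝ) ^ (-s.re) := by
    rw [Complex.norm_natCast_cpow_of_pos hq0, Complex.neg_re]
  have hx1 : ‖(q : ℂ) ^ (-s)‖ ≤ 1 := by
    rw [hx]
    exact Real.rpow_le_one_of_one_le_of_nonpos hq'.le (by linarith)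
  have hδ : M ^ 2 * ‖(q : ℂ) ^ (-s)‖ < 1 := by
    rw [hx]
    calc M ^ 2 * (q : ℝ) ^ (-s.re) < M ^ 2 * (M ^ 2)⁻¹ := mul_lt_mul_of_pos_left (hr₀ _ hsr) hM2
      _ = 1 := mul_inv_cancel₀ hM2.ne'
  exact eval_asaiLocalPolynomial_ne_zero_of_norm_le c A η w hM1 hx1 hwM hcwM hδ

/-- The unramified Asai factor `s ↦ det(1 - As^η(t_v) q^{-s})` is an entire function of `s`
(a polynomial in `q^{-s}`). [folklore] -/
theorem differentiable_eval_asaiLocalPolynomial_cpow (c : E ≃ₐ[F] E) (A : SatakeFamily E)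
    (η : ℤˣ) (w : HeightOneSpectrum (𝓞 E)) {q : ℕ} (hq : 0 < q) :
    Differentiable ℂ fun s : ℂ => (asaiLocalPolynomial c A η w).eval ((q : ℂ) ^ (-s)) := by
  have h0 : (q : ℂ) ≠ 0 := by exact_mod_cast hq.ne'
  have hc : Differentiable ℂ fun s : ℂ => (q : ℂ) ^ (-s) :=
    differentiable_neg.const_cpow (Or.inl h0)
  exact (asaiLocalPolynomial c A η w).differentiable.comp hc

variable [NumberField F] [NumberField E] in
/-- The partial Asai `L`-function off `S` depends on the Satake family only above the complement of
`S`. [folklore] -/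
theorem partialAsaiL_congr (S : Set (HeightOneSpectrum (𝓞 F))) (c : E ≃ₐ[F] E)
    {A A' : SatakeFamily E}
    (h : ∀ w : HeightOneSpectrum (𝓞 E), w.under (𝓞 F) ∉ S → A w = A' w) :
    partialAsaiL S c A = partialAsaiL S c A' := by
  funext η s
  unfold partialAsaiL
  refine tprod_congr fun v => ?_
  rw [asaiLocalPolynomial_congr η (h _ (by rw [placeAbove_under]; exact v.2))
    (h _ (by rw [HeightOneSpectrum.under_algEquiv_smul, placeAbove_under]; exact v.2))]

variable [NumberField F]

/-- **Splitting off finitely many Euler factors of a partial Asai product.** For `S ⊆ S'` with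
`S' ∖ S` finite and any `s` at which the product over `v ∉ S'` is multipliable,
`L^S(s, A, As^η) = (∏_{v ∈ S' ∖ S} det(1 - As^η(t_v) q_v^{-s})⁻¹) · L^{S'}(s, A, As^η)` (the product
over `v ∉ S` splits along the finite set `{v ∈ S'}` and its complement, Mathlib
`Multipliable.tprod_mul_tprod_compl`; same bookkeeping as `partialPairL_eq_prod_mul_partialPairL`).
[folklore] -/
theorem partialAsaiL_eq_prod_mul_partialAsaiL {S S' : Set (HeightOneSpectrum (𝓞 F))}
    (hSS' : S ⊆ S') (hfin : (S' \ S).Finite) (c : E ≃ₐ[F] E) (A : SatakeFamily E) (η : ℤˣ)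
    {s : ℂ}
    (hmul : Multipliable fun v : {v : HeightOneSpectrum (𝓞 F) // v ∉ S'} =>
      ((asaiLocalPolynomial c A η (placeAbove E v.1)).eval ((v.1.residueCard : ℂ) ^ (-s)))⁻¹) :
    partialAsaiL S c A η s =
      (∏ v ∈ hfin.toFinset,
          ((asaiLocalPolynomial c A η (placeAbove E v)).eval ((v.residueCard : ℂ) ^ (-s)))⁻¹) *
        partialAsaiL S' c A η s := by
  classical
  set f : HeightOneSpectrum (𝓞 F) → ℂ := fun v =>
    ((asaiLocalPolynomial c A η (placeAbove E v)).eval ((v.residueCard : ℂ) ^ (-s)))⁻¹ with hf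
  -- the index set `{v ∉ S}` and its finite part `T = {v ∈ S'}`
  set T : Set {v : HeightOneSpectrum (𝓞 F) // v ∉ S} := {v | v.1 ∈ S'} with hT
  let eT : {v : HeightOneSpectrum (𝓞 F) // v ∈ hfin.toFinset} ≃ T :=
    { toFun := fun v => ⟨⟨v.1, (hfin.mem_toFinset.mp v.2).2⟩, (hfin.mem_toFinset.mp v.2).1⟩
      invFun := fun v => ⟨v.1.1, hfin.mem_toFinset.mpr ⟨v.2, v.1.2⟩⟩
      left_inv := fun _ => rfl
      right_inv := fun _ => rfl }
  let eC : {v : HeightOneSpectrum (𝓞 F) // v ∉ S'} ≃ (Tᶜ : Set _) :=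
    { toFun := fun v => ⟨⟨v.1, fun h => v.2 (hSS' h)⟩, fun h => v.2 h⟩
      invFun := fun v => ⟨v.1.1, fun h => v.2 h⟩
      left_inv := fun _ => rfl
      right_inv := fun _ => rfl }
  haveI : Finite T := Finite.of_equiv _ eT
  have hmulT : Multipliable ((fun v : {v : HeightOneSpectrum (𝓞 F) // v ∉ S} => f v.1) ∘
      ((↑) : T → {v : HeightOneSpectrum (𝓞 F) // v ∉ S})) :=
    Multipliable.of_finite
  have hmulC : Multipliable ((fun v : {v : HeightOneSpectrum (𝓞 F) // v ∉ S} => f v.1) ∘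
      ((↑) : (Tᶜ : Set _) → {v : HeightOneSpectrum (𝓞 F) // v ∉ S})) := by
    have h : Multipliable (((fun v : {v : HeightOneSpectrum (𝓞 F) // v ∉ S} => f v.1) ∘
        ((↑) : (Tᶜ : Set _) → {v : HeightOneSpectrum (𝓞 F) // v ∉ S})) ∘ eC) := hmul
    exact eC.multipliable_iff.mp h
  have hsplit := hmulT.tprod_mul_tprod_compl hmulC
  have hTprod : ∏' v : T, f v.1.1 = ∏ v ∈ hfin.toFinset, f v := by
    rw [← eT.tprod_eq (fun v : T => f v.1.1), ← Finset.tprod_subtype hfin.toFinset f]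
    rfl
  have hCprod : ∏' v : (Tᶜ : Set _), f v.1.1 = partialAsaiL S' c A η s := by
    rw [← eC.tprod_eq (fun v : (Tᶜ : Set _) => f v.1.1)]
    rfl
  calc partialAsaiL S c A η s = ∏' v : {v : HeightOneSpectrum (𝓞 F) // v ∉ S}, f v.1 := rfl
    _ = (∏' v : T, f v.1.1) * ∏' v : (Tᶜ : Set _), f v.1.1 := hsplit.symm
    _ = _ := by rw [hTprod, hCprod]

/-- **Enlarging `S` multiplies `L^S` by the removed unramified factors**, where these do not vanish:
for `S ⊆ S'`, `S' ∖ S` finite, the product over `v ∉ S'` multipliable at `s` and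
`det(1 - As^η(t_v) q_v^{-s}) ≠ 0` for `v ∈ S' ∖ S`,
`L^{S'}(s, A, As^η) = (∏_{v ∈ S' ∖ S} det(1 - As^η(t_v) q_v^{-s})) · L^S(s, A, As^η)`. [folklore] -/
theorem partialAsaiL_eq_prod_mul_partialAsaiL_of_ne_zero {S S' : Set (HeightOneSpectrum (𝓞 F))}
    (hSS' : S ⊆ S') (hfin : (S' \ S).Finite) (c : E ≃ₐ[F] E) (A : SatakeFamily E) (η : ℤˣ)
    {s : ℂ}
    (hmul : Multipliable fun v : {v : HeightOneSpectrum (𝓞 F) // v ∉ S'} =>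
      ((asaiLocalPolynomial c A η (placeAbove E v.1)).eval ((v.1.residueCard : ℂ) ^ (-s)))⁻¹)
    (hne : ∀ v ∈ hfin.toFinset,
      (asaiLocalPolynomial c A η (placeAbove E v)).eval ((v.residueCard : ℂ) ^ (-s)) ≠ 0) :
    partialAsaiL S' c A η s =
      (∏ v ∈ hfin.toFinset,
          (asaiLocalPolynomial c A η (placeAbove E v)).eval ((v.residueCard : ℂ) ^ (-s))) *
        partialAsaiL S c A η s := by
  rw [partialAsaiL_eq_prod_mul_partialAsaiL hSS' hfin c A η hmul, ← mul_assoc,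
    ← Finset.prod_mul_distrib, Finset.prod_eq_one (fun v hv => mul_inv_cancel₀ (hne v hv)),
    one_mul]

end Local

/-! ### Continued poles and holomorphic continuations of partial Asai functions of one family -/

section Family

variable {F E : Type} [Field F] [NumberField F] [Field E] [Algebra F E]

/-- **A holomorphic continuation survives enlarging `S`.** If `L^S(s, A, As^η)` agrees on a right
half-plane with a function `H` holomorphic on `{1/2 < Re s}`, `S ⊆ S'` with `S' ∖ S` finite, and the
product over `v ∉ S'` is multipliable far to the right, then `L^{S'}(s, A, As^η)` agrees on a right
half-plane with the holomorphic function `H · ∏_{v ∈ S' ∖ S} det(1 - As^η(t_v) q_v^{-s})` (finitely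
many entire factors, non-zero far to the right). This is the harmless half of "partial versus
complete `L`-functions: finitely many local factors". [folklore] -/
theorem exists_continuation_partialAsaiL_of_subset {S S' : Set (HeightOneSpectrum (𝓞 F))}
    (hSS' : S ⊆ S') (hfin : (S' \ S).Finite) (c : E ≃ₐ[F] E) (A : SatakeFamily E) (η : ℤˣ)
    {σm : ℝ}
    (hmul : ∀ s : ℂ, σm < s.re →
      Multipliable fun v : {v : HeightOneSpectrum (𝓞 F) // v ∉ S'} =>
        ((asaiLocalPolynomial c A η (placeAbove E v.1)).eval ((v.1.residueCard : ℂ) ^ (-s)))⁻¹)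
    {σ₁ : ℝ} {H : ℂ → ℂ} (hH : DifferentiableOn ℂ H {s : ℂ | 1 / 2 < s.re})
    (hHL : ∀ s : ℂ, σ₁ < s.re → H s = partialAsaiL S c A η s) :
    ∃ (σ' : ℝ) (H' : ℂ → ℂ), DifferentiableOn ℂ H' {s : ℂ | 1 / 2 < s.re} ∧
      ∀ s : ℂ, σ' < s.re → H' s = partialAsaiL S' c A η s := by
  classical
  -- thresholds beyond which the finitely many removed factors do not vanish
  choose σv hσv using fun v : HeightOneSpectrum (𝓞 F) =>
    exists_forall_eval_asaiLocalPolynomial_ne_zero c A (placeAbove E v) v.one_lt_residueCard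
  set σ₂ : ℝ := ∑ v ∈ hfin.toFinset, |σv v| with hσ₂
  have hσ₂v : ∀ v ∈ hfin.toFinset, σv v ≤ σ₂ := fun v hv =>
    (le_abs_self _).trans (Finset.single_le_sum (fun u _ => abs_nonneg (σv u)) hv)
  refine ⟨max (max σ₁ σm) σ₂, fun s => H s *
      ∏ v ∈ hfin.toFinset,
        (asaiLocalPolynomial c A η (placeAbove E v)).eval ((v.residueCard : ℂ) ^ (-s)), ?_, ?_⟩
  · exact hH.mul (DifferentiableOn.fun_finsetProd fun v _ =>
      (differentiable_eval_asaiLocalPolynomial_cpow c A η (placeAbove E v)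
        (zero_lt_one.trans v.one_lt_residueCard)).differentiableOn)
  · intro s hs
    have hs₁ : σ₁ < s.re := lt_of_le_of_lt ((le_max_left _ _).trans (le_max_left _ _)) hs
    have hsm : σm < s.re := lt_of_le_of_lt ((le_max_right _ _).trans (le_max_left _ _)) hs
    have hs₂ : σ₂ < s.re := lt_of_le_of_lt (le_max_right _ _) hs
    have hne : ∀ v ∈ hfin.toFinset,
        (asaiLocalPolynomial c A η (placeAbove E v)).eval ((v.residueCard : ℂ) ^ (-s)) ≠ 0 :=
      fun v hv => hσv v η s (lt_of_le_of_lt (hσ₂v v hv) hs₂)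
    show H s * _ = _
    rw [hHL s hs₁, partialAsaiL_eq_prod_mul_partialAsaiL_of_ne_zero hSS' hfin c A η (hmul s hsm) hne,
      mul_comm]

/-- **A continued simple pole for `S'` excludes a holomorphic continuation for `S ⊆ S'`** (same
family, same sign): transport the continuation up to `S'` (`exists_continuation_partialAsaiL_of_subset`)
and compare with the pole on the convex half-plane `{1/2 < Re s}` (`continuation_pole_not_holomorphic`).
[folklore] -/
theorem false_of_pole_of_continuation_subset {S S' : Set (HeightOneSpectrum (𝓞 F))}
    (hSS' : S ⊆ S') (hfin : (S' \ S).Finite) (c : E ≃ₐ[F] E) (A : SatakeFamily E) (η : ℤˣ)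
    {σm : ℝ}
    (hmul : ∀ s : ℂ, σm < s.re →
      Multipliable fun v : {v : HeightOneSpectrum (𝓞 F) // v ∉ S'} =>
        ((asaiLocalPolynomial c A η (placeAbove E v.1)).eval ((v.1.residueCard : ℂ) ^ (-s)))⁻¹)
    {σ₀ : ℝ} (hσ₀ : 1 ≤ σ₀) {G : ℂ → ℂ} (hG : DifferentiableOn ℂ G {s : ℂ | 1 / 2 < s.re})
    (hGL : ∀ s : ℂ, σ₀ < s.re → G s = (s - 1) * partialAsaiL S' c A η s) (hG1 : G 1 ≠ 0)
    {σ₁ : ℝ} {H : ℂ → ℂ} (hH : DifferentiableOn ℂ H {s : ℂ | 1 / 2 < s.re})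
    (hHL : ∀ s : ℂ, σ₁ < s.re → H s = partialAsaiL S c A η s) : False := by
  obtain ⟨σ', H', hH', hH'L⟩ :=
    exists_continuation_partialAsaiL_of_subset hSS' hfin c A η hmul hH hHL
  exact continuation_pole_not_holomorphic hσ₀ hG hGL hG1 hH' hH'L

/-- **The pole sign does not depend on the finite set of places** (same family): if for `S` the
sign `-θ` is continued holomorphically to `{1/2 < Re s}` while for `S' ⊇ S` (`S' ∖ S` finite) the
sign `θ'` carries a continued simple pole at `s = 1`, then `θ = θ'` — otherwise `θ' = -θ` and
`false_of_pole_of_continuation_subset` applies. [folklore] -/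
theorem sign_eq_of_continuations_subset {S S' : Set (HeightOneSpectrum (𝓞 F))} (hSS' : S ⊆ S')
    (hfin : (S' \ S).Finite) (c : E ≃ₐ[F] E) (A : SatakeFamily E) {θ θ' : ℤˣ} {σm : ℝ}
    (hmul : ∀ (η : ℤˣ) (s : ℂ), σm < s.re →
      Multipliable fun v : {v : HeightOneSpectrum (𝓞 F) // v ∉ S'} =>
        ((asaiLocalPolynomial c A η (placeAbove E v.1)).eval ((v.1.residueCard : ℂ) ^ (-s)))⁻¹)
    (hPole : ∃ σ₀ : ℝ, 1 ≤ σ₀ ∧ ∃ G : ℂ → ℂ, DifferentiableOn ℂ G {s : ℂ | 1 / 2 < s.re} ∧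
      (∀ s : ℂ, σ₀ < s.re → G s = (s - 1) * partialAsaiL S' c A θ' s) ∧ G 1 ≠ 0)
    (hHol : ∃ (σ₁ : ℝ) (H : ℂ → ℂ), DifferentiableOn ℂ H {s : ℂ | 1 / 2 < s.re} ∧
      ∀ s : ℂ, σ₁ < s.re → H s = partialAsaiL S c A (-θ) s) : θ = θ' := by
  by_contra hne
  obtain rfl : θ' = -θ := (Int.units_ne_iff_eq_neg.mp (Ne.symm hne))
  obtain ⟨σ₀, hσ₀, G, hG, hGL, hG1⟩ := hPole
  obtain ⟨σ₁, H, hH, hHL⟩ := hHol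
  exact false_of_pole_of_continuation_subset hSS' hfin c A (-θ) (hmul (-θ)) hσ₀ hG hGL hG1 hH hHL

variable [NumberField E]

/-- **The dichotomy for one Asai datum, from holomorphy and Rankin–Selberg** (Grbac–Shahidi's order
count, on `{1/2 < Re s}`).  For `[E : F] = 2`, `c ≠ 1`, a set `S` of finite places of `F` off which
the `c`-fixed places are inert, a Satake family `A`, `σ ≥ 1` beyond which both partial Asai products
and the partial Rankin–Selberg product `R(s) = L^{S_E}(s, A ⊗ A^c)` are multipliable, `R` holomorphic
on `{1 < Re s}` with `(s - 1) R(s) → r ≠ 0` at `1⁺`, and continuations `G_±` of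
`(s - 1) L^S(s, A, As^±)` holomorphic on `{1/2 < Re s}`: there is a sign `θ` such that `G_θ(1) ≠ 0`
(continued simple pole) and `L^S(s, A, As^{-θ})` has a continuation `H` to `{1/2 < Re s}` with
`H(1) ≠ 0`.  (`(∗∗)` near `1⁺` by `eventually_mul_eq_sq_mul_partialPairL`, then
`dichotomy_of_continuations_half_plane`.)
[cite: GrbacShahidi2015, proof of Thm. 4.3, pp. 205–206] [cite: Mok2014, §2.5 before Thm. 2.5.4] -/
theorem exists_sign_partialAsaiL_of_continuations (h2 : Module.finrank F E = 2) {c : E ≃ₐ[F] E}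
    (hc : c ≠ 1) {S : Set (HeightOneSpectrum (𝓞 F))} {A : SatakeFamily E}
    (hinert : ∀ w : HeightOneSpectrum (𝓞 E), w.under (𝓞 F) ∉ S → c • w = w →
      w.asIdeal.inertiaDeg (𝓞 F) = 2)
    {σ : ℝ} (hσ : 1 ≤ σ)
    (hmulA : ∀ (θ : ℤˣ) (s : ℂ), σ < s.re →
      Multipliable fun v : {v : HeightOneSpectrum (𝓞 F) // v ∉ S} =>
        ((asaiLocalPolynomial c A θ (placeAbove E v.1)).eval ((v.1.residueCard : ℂ) ^ (-s)))⁻¹)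
    (hmulP : ∀ s : ℂ, σ < s.re →
      Multipliable fun w : {w : HeightOneSpectrum (𝓞 E) // w.under (𝓞 F) ∉ S} =>
        ((satakePairPolynomial (A w.1) (A (c • w.1))).eval ((w.1.residueCard : ℂ) ^ (-s)))⁻¹)
    (hRhol : DifferentiableOn ℂ
      (partialPairL {w : HeightOneSpectrum (𝓞 E) | w.under (𝓞 F) ∈ S} A (fun w => A (c • w)))
      {s : ℂ | 1 < s.re})
    {r : ℂ} (hr : r ≠ 0)
    (hpole : Tendsto (fun s => (s - 1) *
        partialPairL {w : HeightOneSpectrum (𝓞 E) | w.under (𝓞 F) ∈ S} A (fun w => A (c • w)) s)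
      (𝓝[{s : ℂ | 1 < s.re}] 1) (𝓝 r))
    {G₁ G₂ : ℂ → ℂ} (hG₁ : DifferentiableOn ℂ G₁ {s : ℂ | 1 / 2 < s.re})
    (hG₂ : DifferentiableOn ℂ G₂ {s : ℂ | 1 / 2 < s.re})
    (hGL₁ : ∀ s : ℂ, σ < s.re → G₁ s = (s - 1) * partialAsaiL S c A 1 s)
    (hGL₂ : ∀ s : ℂ, σ < s.re → G₂ s = (s - 1) * partialAsaiL S c A (-1) s) :
    ∃ θ : ℤˣ,
      (∃ G : ℂ → ℂ, DifferentiableOn ℂ G {s : ℂ | 1 / 2 < s.re} ∧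
        (∀ s : ℂ, σ < s.re → G s = (s - 1) * partialAsaiL S c A θ s) ∧ G 1 ≠ 0) ∧
      (∃ H : ℂ → ℂ, DifferentiableOn ℂ H {s : ℂ | 1 / 2 < s.re} ∧
        (∀ s : ℂ, σ < s.re → H s = partialAsaiL S c A (-θ) s) ∧ H 1 ≠ 0) := by
  have hfac := eventually_mul_eq_sq_mul_partialPairL h2 hc hinert hσ hmulA hmulP hRhol
    (hG₁.mono one_lt_re_union_ball_one_half_subset) (hG₂.mono one_lt_re_union_ball_one_half_subset)
    hGL₁ hGL₂
  rcases dichotomy_of_continuations_half_plane hσ hG₁ hG₂ hGL₁ hGL₂ hr hpole hfac with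
    ⟨h1, hH⟩ | ⟨h2', hH⟩
  · exact ⟨1, ⟨G₁, hG₁, hGL₁, h1⟩, hH⟩
  · refine ⟨-1, ⟨G₂, hG₂, hGL₂, h2'⟩, ?_⟩
    rw [neg_neg]
    exact hH

end Family

/-! ### The reduction of the named fact to holomorphy and Rankin–Selberg -/

section Reduction

/-- **Mok's Asai-pole dichotomy in continuation form, from holomorphy (Grbac–Shahidi, Thm. 4.3
(2)(a)) and Rankin–Selberg (Jacquet–Shalika).**

*Hypothesis `hHol`* — the holomorphy content of Grbac–Shahidi 2015, Thm. 4.3 (2)(a) ("If `σ` is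
Galois self-dual … `L(s, σ, r_A)` is entire, except for possible simple poles at `s = 0` and
`s = 1`"; likewise for `L(s, σ ⊗ δ̂, r_A) = L(s, σ, As⁻)`, `σ ⊗ δ̂` being Galois self-dual as well),
for the partial functions of the tree on the half-plane of the fact: for `[E : F] = 2`, `c ≠ 1`, a
conjugate self-dual cuspidal `Π` on `GL_N(𝔸_E)`, `N ≥ 1` (`IsConjSelfDualAE`), every Asai datum
`(S, A)` and every sign `η`, there are `σ₀ ≥ 1` and `G` holomorphic on `{1/2 < Re s}` with
`G(s) = (s - 1) L^S(s, Π, As^η)` for `Re s > σ₀`.  Nothing is assumed about zeros or about which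
sign has the pole.  (Printed proof: Langlands–Shahidi method on `U(n, n)` — Thm. 2.1, the constant
term `L(2s, σ, r_A)/L(1 + 2s, σ, r_A)` of the Siegel Eisenstein series; Thm. 4.1, its poles for
`Re s > 0`, through Mok's endoscopic classification; the functional equation —; none of it is in the
tree.)

*Hypothesis `hRS`* — Jacquet–Shalika for the pair `(Π, Π^c)` over `E` (Arthur–Clozel, Ch. 3, (2.1),
(2.3); Mok: "`L(s, φ^N × (φ^N)^c) = L(s, φ^N × (φ^N)^∨)`, hence has a simple pole at `s = 1` by
[JPSS]"): for the same `Π` and datum, the raw product `R(s) = L^{S_E}(s, A ⊗ A^c)` off the places of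
`E` above `S` is multipliable and holomorphic on `{1 < Re s}` and `(s - 1) R(s) → r ≠ 0` as `s → 1`,
`Re s > 1` — the statements of `JacquetShalika1981_partialPairL_{multipliable,pole}_repData` for
`(Π, Π^c)` (`t_{Π^c, w} = t_{Π, c w}`, and `1 ∈ X` by conjugate self-duality), kept as a hypothesis
because the tree has no Galois-conjugate Borel–Jacquet datum `Π^c`.

*Conclusion*: `Mok2014_partialAsaiL_continuation_pole_dichotomy` verbatim.  Proof: clause (i) is
`CuspidalAutomorphicRepData.exists_multipliable_asaiEulerFactors`; for each datum the order count
(`exists_sign_partialAsaiL_of_continuations`) gives a sign `θ(S, A)` with the continued simple pole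
and the other sign continued and non-zero at `1`; `θ` does not depend on the datum: compare `(S, A)`
and `(S₀, A₀)` with `(S ∪ S₀, A)` and `(S ∪ S₀, A₀)` by `sign_eq_of_continuations_subset`, using
`A = A₀` above the complement of `S ∪ S₀` (`AutomorphicRepData.hasSatakeParamAt_unique_holds`,
`partialAsaiL_congr`).
[cite: GrbacShahidi2015, Thm. 4.3 (2) and its proof, pp. 204–206]
[cite: Mok2014, §2.5 (paragraph before Thm. 2.5.4) and Thm. 2.5.4 (a)]
[cite: ArthurClozelAMS120, Ch. 3 §2 (2.3)] [cite: FlathCorvallis1979, Thm. 3] -/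
theorem Mok2014_partialAsaiL_continuation_pole_dichotomy_of_holomorphy
    (hHol : ∀ (F E : Type) [Field F] [NumberField F] [Field E] [NumberField E] [Algebra F E]
      (c : E ≃ₐ[F] E), Module.finrank F E = 2 → c ≠ 1 →
      ∀ (N : ℕ) (hcpt : isCompact_glFiniteIntegralLevel N E)
        (π : CuspidalAutomorphicRepData N E hcpt), 0 < N → π.1.IsConjSelfDualAE c →
        ∀ (S : Set (HeightOneSpectrum (𝓞 F))) (A : SatakeFamily E) (η : ℤˣ),
          π.1.IsAsaiDatum c S A →
          ∃ σ₀ : ℝ, 1 ≤ σ₀ ∧ ∃ G : ℂ → ℂ, DifferentiableOn ℂ G {s : ℂ | 1 / 2 < s.re} ∧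
            ∀ s : ℂ, σ₀ < s.re → G s = (s - 1) * partialAsaiL S c A η s)
    (hRS : ∀ (F E : Type) [Field F] [NumberField F] [Field E] [NumberField E] [Algebra F E]
      (c : E ≃ₐ[F] E), Module.finrank F E = 2 → c ≠ 1 →
      ∀ (N : ℕ) (hcpt : isCompact_glFiniteIntegralLevel N E)
        (π : CuspidalAutomorphicRepData N E hcpt), 0 < N → π.1.IsConjSelfDualAE c →
        ∀ (S : Set (HeightOneSpectrum (𝓞 F))) (A : SatakeFamily E), π.1.IsAsaiDatum c S A →
          (∀ s : ℂ, 1 < s.re →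
            Multipliable fun w : {w : HeightOneSpectrum (𝓞 E) // w.under (𝓞 F) ∉ S} =>
              ((satakePairPolynomial (A w.1) (A (c • w.1))).eval
                ((w.1.residueCard : ℂ) ^ (-s)))⁻¹) ∧
          DifferentiableOn ℂ
            (partialPairL {w : HeightOneSpectrum (𝓞 E) | w.under (𝓞 F) ∈ S} A (fun w => A (c • w)))
            {s : ℂ | 1 < s.re} ∧
          ∃ r : ℂ, r ≠ 0 ∧
            Tendsto (fun s => (s - 1) *
                partialPairL {w : HeightOneSpectrum (𝓞 E) | w.under (𝓞 F) ∈ S} A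
                  (fun w => A (c • w)) s)
              (𝓝[{s : ℂ | 1 < s.re}] 1) (𝓝 r)) :
    Mok2014_partialAsaiL_continuation_pole_dichotomy := by
  intro F E _ _ _ _ _ c h2 hc N hcpt π hN hπ
  classical
  -- the dichotomy for ONE datum, in the shape of the fact, with its own sign `θ`
  have datum : ∀ (S : Set (HeightOneSpectrum (𝓞 F))) (A : SatakeFamily E), π.1.IsAsaiDatum c S A →
      ∃ (θ : ℤˣ) (σ₀ : ℝ), 1 ≤ σ₀ ∧
        (∀ (θ' : ℤˣ) (s : ℂ), σ₀ < s.re →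
          Multipliable fun v : {v : HeightOneSpectrum (𝓞 F) // v ∉ S} =>
            ((asaiLocalPolynomial c A θ' (placeAbove E v.1)).eval
              ((v.1.residueCard : ℂ) ^ (-s)))⁻¹) ∧
        (∃ G : ℂ → ℂ, DifferentiableOn ℂ G {s : ℂ | 1 / 2 < s.re} ∧
          (∀ s : ℂ, σ₀ < s.re → G s = (s - 1) * partialAsaiL S c A θ s) ∧ G 1 ≠ 0) ∧
        (∃ H : ℂ → ℂ, DifferentiableOn ℂ H {s : ℂ | 1 / 2 < s.re} ∧
          (∀ s : ℂ, σ₀ < s.re → H s = partialAsaiL S c A (-θ) s) ∧ H 1 ≠ 0) := by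
    intro S A hSA
    obtain ⟨σ₁, hσ₁, hmulA⟩ := π.exists_multipliable_asaiEulerFactors h2 hN hSA
    obtain ⟨σp, -, Gp, hGp, hGLp⟩ := hHol F E c h2 hc N hcpt π hN hπ S A 1 hSA
    obtain ⟨σn, -, Gn, hGn, hGLn⟩ := hHol F E c h2 hc N hcpt π hN hπ S A (-1) hSA
    obtain ⟨hmulP, hRhol, r, hr, hpole⟩ := hRS F E c h2 hc N hcpt π hN hπ S A hSA
    -- a common right half-plane `{σ < Re s}`
    set σ : ℝ := max σ₁ (max σp σn) with hσdef
    have hσ₁σ : σ₁ ≤ σ := le_max_left _ _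
    have hσ : 1 ≤ σ := hσ₁.trans hσ₁σ
    have hσpσ : σp ≤ σ := (le_max_left _ _).trans (le_max_right _ _)
    have hσnσ : σn ≤ σ := (le_max_right _ _).trans (le_max_right _ _)
    have hmulA' : ∀ (θ : ℤˣ) (s : ℂ), σ < s.re →
        Multipliable fun v : {v : HeightOneSpectrum (𝓞 F) // v ∉ S} =>
          ((asaiLocalPolynomial c A θ (placeAbove E v.1)).eval ((v.1.residueCard : ℂ) ^ (-s)))⁻¹ :=
      fun θ s hs => hmulA θ s (lt_of_le_of_lt hσ₁σ hs)
    have hmulP' : ∀ s : ℂ, σ < s.re →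
        Multipliable fun w : {w : HeightOneSpectrum (𝓞 E) // w.under (𝓞 F) ∉ S} =>
          ((satakePairPolynomial (A w.1) (A (c • w.1))).eval ((w.1.residueCard : ℂ) ^ (-s)))⁻¹ :=
      fun s hs => hmulP s (lt_of_le_of_lt hσ hs)
    have hGLp' : ∀ s : ℂ, σ < s.re → Gp s = (s - 1) * partialAsaiL S c A 1 s :=
      fun s hs => hGLp s (lt_of_le_of_lt hσpσ hs)
    have hGLn' : ∀ s : ℂ, σ < s.re → Gn s = (s - 1) * partialAsaiL S c A (-1) s :=
      fun s hs => hGLn s (lt_of_le_of_lt hσnσ hs)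
    have hinert : ∀ w : HeightOneSpectrum (𝓞 E), w.under (𝓞 F) ∉ S → c • w = w →
        w.asIdeal.inertiaDeg (𝓞 F) = 2 := fun w hw hcw => hSA.inertiaDeg_eq_two hw hcw
    obtain ⟨θ, hP, hH⟩ := exists_sign_partialAsaiL_of_continuations h2 hc hinert hσ hmulA' hmulP'
      hRhol hr hpole hGp hGn hGLp' hGLn'
    exact ⟨θ, σ, hσ, hmulA', hP, hH⟩
  -- no Asai datum at all: any sign will do
  by_cases hex : ∃ (S₀ : Set (HeightOneSpectrum (𝓞 F))) (A₀ : SatakeFamily E), π.1.IsAsaiDatum c S₀ A₀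
  swap
  · exact ⟨1, fun S A hSA => absurd ⟨S, A, hSA⟩ hex⟩
  -- otherwise the sign of a reference datum `(S₀, A₀)` serves for every datum
  obtain ⟨S₀, A₀, h₀⟩ := hex
  obtain ⟨θ₀, σ₀₀, -, -, -, hH₀⟩ := datum S₀ A₀ h₀
  refine ⟨θ₀, fun S A hSA => ?_⟩
  obtain ⟨θ, σ₀, hσ₀, hmul, hP, hH⟩ := datum S A hSA
  suffices hθ : θ = θ₀ by
    subst hθ
    exact ⟨σ₀, hσ₀, hmul, hP, hH⟩
  -- compare through `T = S ∪ S₀`, with the family `A` and with the family `A₀`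
  have hTfin : (S ∪ S₀).Finite := hSA.finite.union h₀.finite
  have hT : π.1.IsAsaiDatum c (S ∪ S₀) A := hSA.mono Set.subset_union_left hTfin
  have hT₀ : π.1.IsAsaiDatum c (S ∪ S₀) A₀ := h₀.mono Set.subset_union_right hTfin
  obtain ⟨θT, σT, hσT, hmulT, hPT, hHT⟩ := datum (S ∪ S₀) A hT
  obtain ⟨θT₀, σT₀, hσT₀, hmulT₀, hPT₀, -⟩ := datum (S ∪ S₀) A₀ hT₀
  -- `A = A₀` above the complement of `T` (uniqueness of Satake parameters), so `L^T(A) = L^T(A₀)`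
  have hAA₀ : partialAsaiL (S ∪ S₀) c A = partialAsaiL (S ∪ S₀) c A₀ :=
    partialAsaiL_congr (S ∪ S₀) c fun w hw =>
      π.1.hasSatakeParamAt_unique_holds (hSA.hasSatakeParamAt fun h => hw (Or.inl h))
        (h₀.hasSatakeParamAt fun h => hw (Or.inr h))
  have hdiff : ((S ∪ S₀) \ S).Finite := hTfin.subset fun _ hv => hv.1
  have hdiff₀ : ((S ∪ S₀) \ S₀).Finite := hTfin.subset fun _ hv => hv.1
  have hdiffT : ((S ∪ S₀) \ (S ∪ S₀)).Finite := hTfin.subset fun _ hv => hv.1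
  obtain ⟨H, hH', hHL, -⟩ := hH
  obtain ⟨H₀, hH₀', hH₀L, -⟩ := hH₀
  obtain ⟨HT, hHT', hHTL, -⟩ := hHT
  have e₁ : θ = θT :=
    sign_eq_of_continuations_subset Set.subset_union_left hdiff c A hmulT ⟨σT, hσT, hPT⟩
      ⟨σ₀, H, hH', hHL⟩
  have e₂ : θ₀ = θT₀ :=
    sign_eq_of_continuations_subset Set.subset_union_right hdiff₀ c A₀ hmulT₀ ⟨σT₀, hσT₀, hPT₀⟩
      ⟨σ₀₀, H₀, hH₀', hH₀L⟩
  have hPT₀' : ∃ G : ℂ → ℂ, DifferentiableOn ℂ G {s : ℂ | 1 / 2 < s.re} ∧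
      (∀ s : ℂ, σT₀ < s.re → G s = (s - 1) * partialAsaiL (S ∪ S₀) c A θT₀ s) ∧ G 1 ≠ 0 := by
    rw [hAA₀]
    exact hPT₀
  have e₃ : θT = θT₀ :=
    sign_eq_of_continuations_subset (Set.Subset.refl (S ∪ S₀)) hdiffT c A hmulT ⟨σT₀, hσT₀, hPT₀'⟩
      ⟨σT, HT, hHT', hHTL⟩
  rw [e₁, e₃, ← e₂]

/-- **Conversely, the fact gives back the holomorphy hypothesis `hHol`** (so that, granted the
Rankin–Selberg input `hRS`, `Mok2014_partialAsaiL_continuation_pole_dichotomy` is EQUIVALENT to the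
holomorphy content of Grbac–Shahidi, Thm. 4.3 (2)(a) on `{1/2 < Re s}` for the partial functions):
for the pole sign `η₀` the continuation `G` of `(s - 1) L^S(s, Π, As^{η₀})` serves, for `-η₀` the
function `(s - 1) H` with `H` the continuation of `L^S(s, Π, As^{-η₀})`.
[cite: GrbacShahidi2015, Thm. 4.3 (2)(a)] [cite: Mok2014, §2.5 and Thm. 2.5.4 (a)] -/
theorem hol_half_plane_of_Mok2014_partialAsaiL_continuation_pole_dichotomy
    (hMok : Mok2014_partialAsaiL_continuation_pole_dichotomy)
    {F E : Type} [Field F] [NumberField F] [Field E] [NumberField E] [Algebra F E]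
    {c : E ≃ₐ[F] E} (h2 : Module.finrank F E = 2) (hc : c ≠ 1)
    {N : ℕ} {hcpt : isCompact_glFiniteIntegralLevel N E} (π : CuspidalAutomorphicRepData N E hcpt)
    (hN : 0 < N) (hπ : π.1.IsConjSelfDualAE c)
    {S : Set (HeightOneSpectrum (𝓞 F))} {A : SatakeFamily E} (η : ℤˣ) (hSA : π.1.IsAsaiDatum c S A) :
    ∃ σ₀ : ℝ, 1 ≤ σ₀ ∧ ∃ G : ℂ → ℂ, DifferentiableOn ℂ G {s : ℂ | 1 / 2 < s.re} ∧
      ∀ s : ℂ, σ₀ < s.re → G s = (s - 1) * partialAsaiL S c A η s := by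
  obtain ⟨η₀, hη₀⟩ := hMok F E c h2 hc N hcpt π hN hπ
  obtain ⟨σ₀, hσ₀, -, ⟨G, hG, hGL, -⟩, ⟨H, hH, hHL, -⟩⟩ := hη₀ S A hSA
  by_cases hη : η = η₀
  · subst hη
    exact ⟨σ₀, hσ₀, G, hG, hGL⟩
  · obtain rfl : η = -η₀ := Int.units_ne_iff_eq_neg.mp hη
    exact ⟨σ₀, hσ₀, fun s => (s - 1) * H s, (differentiableOn_id.sub_const 1).mul hH,
      fun s hs => by show (s - 1) * H s = _; rw [hHL s hs]⟩

end Reduction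

end Literature.NumberTheory.Automorphic

end
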